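import Mathlib.GroupTheory.PushoutI
import Mathlib.GroupTheory.FreeGroup.CyclicallyReduced
import HarnessLib

/-!
# Words on disjoint alphabets are not identified by one relation

Topic `Literature/GroupTheory/CombinatorialGroupTheory`.  Let `F = F(ι)` be a free group and let
`p = mk L`, `q = mk M` be non-trivial elements written on *disjoint* alphabets (the symbols of
`L` satisfy a predicate `S`, those of `M` do not).  Then `p` survives in the one-relator group
`F / ⟪p q⟫`: `p ∉ normalClosure {p q}` (`mk_notMem_normalClosure_mk_mul_mk`).

Proof: map `F` to the amalgamated product `F *_ℤ F` of two copies of `F` along the infinite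
cyclic subgroups generated by `p` in the first copy and by `q⁻¹` in the second (an honest
amalgam: free groups are torsion free, so `n ↦ pⁿ` and `n ↦ q⁻ⁿ` are injective,
`zpowersHom_injective`), sending the symbols in `S` to the first factor and the other symbols
to the second.  Then `p q ↦ p · q = q⁻¹ · q = 1`, whereas `p ↦ p ≠ 1` because the factors
embed in an amalgam (`Monoid.PushoutI.of_injective`).  This is the algebraic heart of the
*block lemma* of Zieschang's proof of Nielsen's theorem (ZVC LNM 835, Thm. 5.3.6: the canonical
binary product is indecomposable — the boundary of a proper sub-dissection of the canonical
one-vertex dissection of a closed orientable surface is essential), see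
`Literature/Topology/FourManifolds/SurfaceGroupNielsenBlockLemma.lean`.

## References

* H. Zieschang, E. Vogt, H.-D. Coldewey, *Surfaces and Planar Discontinuous Groups*, LNM 835,
  Springer (1980), §5.3 (Thm. 5.3.6). [ZieschangVogtColdewey1980]
* R. C. Lyndon, P. E. Schupp, *Combinatorial Group Theory*, Springer (1977), IV §2 (free
  products with amalgamation and their normal form).
-/

namespace Literature.GroupTheory.CombinatorialGroupTheory

open List

/-- In a torsion-free group the powers `n ↦ xⁿ` of a non-trivial element are pairwise distinct:
`zpowersHom G x : ℤ →* G` is injective. [folklore] -/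
theorem zpowersHom_injective {G : Type*} [Group G] [IsMulTorsionFree G] {x : G} (hx : x ≠ 1) :
    Function.Injective (zpowersHom G x) := by
  intro m n hmn
  simp only [zpowersHom_apply] at hmn
  have h : x ^ (m.toAdd - n.toAdd) = 1 := by
    rw [zpow_sub, hmn, mul_inv_cancel]
  rw [IsMulTorsionFree.zpow_eq_one_iff] at h
  rcases h with h | h
  · exact absurd h hx
  · exact Multiplicative.toAdd.injective (sub_eq_zero.1 h)

variable {ι : Type*}

/-- The map `F(ι) → F(ι) *_ℤ F(ι)` sending the symbols in `S` to the first factor and the others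
to the second agrees with the first factor embedding on words in the symbols of `S`, and with the
second on words in the other symbols. [folklore] -/
private theorem lift_mk_eq_of_forall {P : Type*} [Group P] (S : ι → Prop) [DecidablePred S]
    (u v : FreeGroup ι →* P) (b : Bool) (L : List (ι × Bool)) (hL : ∀ x ∈ L, decide (S x.1) = b) :
    FreeGroup.lift (fun s => if S s then u (FreeGroup.of s) else v (FreeGroup.of s))
      (FreeGroup.mk L) = (bif b then u else v) (FreeGroup.mk L) := by
  induction L with
  | nil => simp [show (FreeGroup.mk [] : FreeGroup ι) = 1 from rfl]
  | cons x L ih =>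
    rw [← List.singleton_append, ← FreeGroup.mul_mk, map_mul, map_mul,
      ih fun y hy => hL y (List.mem_cons_of_mem _ hy)]
    congr 1
    have hx := hL x List.mem_cons_self
    obtain ⟨i, _ | _⟩ := x
    · have e : (FreeGroup.mk [(i, false)] : FreeGroup ι) = (FreeGroup.of i)⁻¹ := rfl
      rw [e, map_inv, map_inv, FreeGroup.lift_apply_of]
      by_cases hi : S i
      · simp only [hi, decide_true] at hx; subst hx; simp [hi]
      · simp only [hi, decide_false] at hx; subst hx; simp [hi]
    · have e : (FreeGroup.mk [(i, true)] : FreeGroup ι) = FreeGroup.of i := rfl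
      rw [e, FreeGroup.lift_apply_of]
      by_cases hi : S i
      · simp only [hi, decide_true] at hx; subst hx; simp [hi]
      · simp only [hi, decide_false] at hx; subst hx; simp [hi]

/-- **Non-trivial words on disjoint alphabets are not identified by one relation**: if
`p = mk L ≠ 1` is a word in the symbols of `S` and `q = mk M ≠ 1` a word in the symbols outside
`S`, then `p ≠ 1` in `F(ι) / ⟪p q⟫`, i.e. `p ∉ normalClosure {p q}` — map `F(ι)` onto the
amalgam `F(ι) *_{p = q⁻¹} F(ι)`, in which the factors embed. (The algebraic core of ZVC
Thm. 5.3.6.) [cite: ZieschangVogtColdewey1980, Thm. 5.3.6 (proof)] -/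
theorem mk_notMem_normalClosure_mk_mul_mk (S : ι → Prop) {L M : List (ι × Bool)}
    (hL : ∀ x ∈ L, S x.1) (hM : ∀ x ∈ M, ¬ S x.1)
    (hL1 : FreeGroup.mk L ≠ 1) (hM1 : FreeGroup.mk M ≠ 1) :
    FreeGroup.mk L ∉ Subgroup.normalClosure {FreeGroup.mk L * FreeGroup.mk M} := by
  classical
  intro hmem
  set p := FreeGroup.mk L with hp
  set q := FreeGroup.mk M with hq
  -- the amalgam `F *_ℤ F` of two copies of `F = F(ι)` along `n ↦ pⁿ` and `n ↦ q⁻ⁿ`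
  let φ : ∀ _b : Bool, Multiplicative ℤ →* FreeGroup ι :=
    fun b => bif b then zpowersHom (FreeGroup ι) p else zpowersHom (FreeGroup ι) q⁻¹
  have hφ : ∀ b, Function.Injective (φ b) := by
    rintro (_ | _)
    · exact zpowersHom_injective (inv_ne_one.2 hM1)
    · exact zpowersHom_injective hL1
  -- symbols in `S` go to the first (`true`) copy, the others to the second (`false`) copy
  let Θ : FreeGroup ι →* Monoid.PushoutI φ :=
    FreeGroup.lift fun s => if S s then Monoid.PushoutI.of (φ := φ) true (FreeGroup.of s)
      else Monoid.PushoutI.of (φ := φ) false (FreeGroup.of s)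
  have hΘp : Θ p = Monoid.PushoutI.of (φ := φ) true p :=
    lift_mk_eq_of_forall S _ _ true L fun x hx => decide_eq_true (hL x hx)
  have hΘq : Θ q = Monoid.PushoutI.of (φ := φ) false q :=
    lift_mk_eq_of_forall S _ _ false M fun x hx => decide_eq_false (hM x hx)
  -- in the amalgam `p = q⁻¹`
  have hrel : Monoid.PushoutI.of (φ := φ) true p = Monoid.PushoutI.of (φ := φ) false q⁻¹ := by
    have h1 := Monoid.PushoutI.of_apply_eq_base φ true (Multiplicative.ofAdd 1)
    have h2 := Monoid.PushoutI.of_apply_eq_base φ false (Multiplicative.ofAdd 1)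
    have e1 : φ true (Multiplicative.ofAdd 1) = p := by simp [φ]
    have e2 : φ false (Multiplicative.ofAdd 1) = q⁻¹ := by simp [φ]
    rw [e1] at h1
    rw [e2] at h2
    rw [h1, h2]
  -- so `Θ` kills `p q`, hence the normal closure of `p q` …
  have hker : Θ (p * q) = 1 := by
    rw [map_mul, hΘp, hΘq, hrel, ← map_mul, inv_mul_cancel, map_one]
  have hle : Subgroup.normalClosure {p * q} ≤ Θ.ker :=
    Subgroup.normalClosure_le_normal (by simpa using hker)
  -- … but not `p`, since the first factor embeds
  have h1 : Θ p = 1 := hle hmem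
  rw [hΘp, ← map_one (Monoid.PushoutI.of (φ := φ) true)] at h1
  exact hL1 (Monoid.PushoutI.of_injective hφ true h1)

end Literature.GroupTheory.CombinatorialGroupTheory
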